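import Summits.Schanuel.Schanuel.Theorems.RootDecomp1BPeriodKernelFloor01

/-!
# `RootDecomp1BPeriodKernelFloor` — part 02 of 02 (`RootDecomp1BPeriodKernelFloor02`): §5 the transcendence package for `E₁`, §6 `NesterenkoE` (`nesterenkoE_exp`, `nesterenkoE_E₁`), §7 the verdicts (`kleinPolar_pi_cell_E₁`, `not_kleinPolarE_E₁`, `not_schanuelRankE_E₁_three`, `not_schanuelE_E₁`), §8 `PeriodPackage` and the headline `_false_without_channel_beyond_periods` theorems, `periodKernelFloor`, `periodPackage_exp_dictionary`

Second part of the port of the lens-4 gen-19 kernel `PeriodKernelFloor.lean` (see part 01 for the construction of `E₁` and the overview).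

# PERIOD-KERNEL FLOOR — `KleinPolarSchanuel` (crux `stmt-Schanuel-24622`), `SchanuelRank 3` and the summit text are FALSE WITHOUT a property of `exp` beyond the PERIOD PACKAGE: the algebraic-point transcendence package (E1)–(E4) of `RootDecomp1BTranscendencePackageFloor05` PLUS the true kernel `2πiℤ`, `E = exp` on `ℚ̄ ⊕ ℚ̄π`, and Nesterenko's theorem verbatim

## Verdicts

* the package: `transcendencePackage_E₁` ((E1) `IsInvolutiveExp`, (E2) `AgreesOnQbar`, (E3)
  Lindemann–Weierstrass, Hermite–Lindemann, Gelfond–Schneider, Baker verbatim, (E4) rank one — as for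
  `E₀`); `periodPackage_E₁` adds (P1) `TrueKernel`, (P2) `AgreesOnPeriodPlane`, (P3) `NesterenkoE`;
  `periodPackage_exp` (the genuine exponential has it too).
* `kleinPolar_pi_cell_E₁`: the LENGTH-ONE Klein-polar cell at `r = (π)` HOLDS for `E₁`
  (`trdeg ℚ(π, iπ, e^π, -1) = 2`, Nesterenko) — the failure below is a genuine storey-two phenomenon.
* `not_kleinPolarE_E₁`: **X(2) FAILS** at the `ℚ`-free real pair `r = (π, e^π)`: the eight
  generators `π, e^π, iπ, ie^π, E₁ π = e^π, E₁ e^π = 2, E₁(iπ) = -1, E₁(ie^π) = 2^i` are algebraic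
  over `K₁ = ℚ(π, e^π, 2^i)`, so `trdeg ≤ 3 < 4`.
* `not_schanuelRankE_E₁_three`: **S(3) FAILS** at the `ℚ`-free, `conj`-stable triple `(iπ, π, e^π)`
  (`trdeg ℚ(iπ, π, e^π, -1, e^π, 2) ≤ 2 < 3`); `not_schanuelE_E₁`.
* headlines: `kleinPolarSchanuel_false_without_channel_beyond_periods`,
  `schanuelRank_three_false_without_channel_beyond_periods`,
  `schanuel_false_without_channel_beyond_periods` (`¬ ∀ E, PeriodPackage E → …`),
  `periodKernelFloor` (existence form), `periodPackage_exp_dictionary` (at `E = exp` the three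
  statements ARE the crux, the tree's `SchanuelRank 3` and the summit `Schanuel`, by `Iff.rfl`).

## Rank cost of the period — what is NOT claimed

Pinning `τ = 2πi` costs one storey: `E₀` (part 05) fails `X` at length `1` and `S` in rank `2`,
`E₁` only at length `2` / rank `3`. For shear models this is forced: a length-one failure at a polar
pair `(u, iu)` with `θ` fixing `π` needs the `ℚ̄`-linear position of a NON-logarithm
(`2cos(log 2)`, `cosh`-type values, …) relative to `{1, π}` — a Baker-type statement outside Baker's
theorem. NOT claimed: `¬ S_{E₁}(2)` (open either way: it would need e.g. `trdeg ℚ(e^π, 2^i) ≤ 1`);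
`¬ LocalSurplusBudgetE E₁`, `¬ TameDefectZeroStepE E₁` (their Klein induction hypothesis at length
one for `E₁` contains open cells such as `trdeg ℚ(e^π, ie^π, 2, 2^i) ≥ 2`); the six exponentials
theorem for `E₁`; anything about `Γ(1/4)` beyond (P3).

PORT VARIANT (lens-4 g20, mechanical): the `variable (hN : nesterenko)` section variables of the
g19 port are replaced by an explicit `(hN : nesterenko)` binder on each declaration that mentions
it (statements and proof terms unchanged; binder order unchanged, `hN` first).
-/

noncomputable section

open Complex

namespace Summit.Schanuel.Schanuel.Theorems.RootDecomp1BPeriodKernelFloor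

set_option linter.dupNamespace false

open Summit.Schanuel.Schanuel.Theorems.RootDecomp1BTranscendencePackageFloor
open Literature.NumberTheory.Transcendental (nesterenko SchanuelRank)

/-- An element of an intermediate field `K` is algebraic over `K` (private copy, as in part 01). [folklore] -/
private theorem isAlgebraic_of_mem' {K : IntermediateField ℚ ℂ} {x : ℂ} (hx : x ∈ K) :
    IsAlgebraic K x :=
  isAlgebraic_algebraMap (⟨x, hx⟩ : K)

/-- `2` is algebraic (private copy). [folklore] -/
private theorem two_isAlgebraic' : IsAlgebraic ℚ (2 : ℂ) := by
  have h : IsAlgebraic ℚ ((2 : ℕ) : ℂ) := isAlgebraic_nat 2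
  simpa using h

/-- `-1` is algebraic (private copy). [folklore] -/
private theorem neg_one_isAlgebraic' : IsAlgebraic ℚ (-1 : ℂ) := by
  have h : IsAlgebraic ℚ ((-1 : ℤ) : ℂ) := isAlgebraic_int (-1)
  simpa using h

/-- `i` is algebraic (private copy). [folklore] -/
private theorem I_isAlgebraic' : IsAlgebraic ℚ I := mem_Qb_iff.mp I_mem_Qb

section Model


/-! ## §5 The transcendence package (E1)–(E4) for `E₁` -/

/-- (E1) for `E₁`. [folklore] -/
theorem isInvolutiveExp_E₁ (hN : nesterenko) : IsInvolutiveExp (E₁ hN) where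
  map_add := (S₁ hN).E_add
  surj := fun _ hw => (S₁ hN).E_surjective hw
  kernel := ⟨(S₁ hN).τ, (S₁ hN).τ_ne_zero, (S₁ hN).conj_τ, (S₁ hN).E_eq_one_iff,
    (S₁ hN).E_τ_div_natCast⟩
  map_conj := (S₁ hN).E_conj
  real_pos := (S₁ hN).E_ofReal_pos
  real_onto := fun _ ht => (S₁ hN).E_real_onto_pos ht
  imag_circle := (S₁ hN).norm_E_ofReal_mul_I
  imag_onto := fun _ hw => (S₁ hN).E_imag_onto_circle hw

/-- (E2) for `E₁`. [folklore] -/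
theorem agreesOnQbar_E₁ (hN : nesterenko) : AgreesOnQbar (E₁ hN) where
  eq_exp := fun _ hq => (S₁ hN).E_of_isAlgebraic hq
  transport := ⟨(S₁ hN).θ, (S₁ hN).θ_bijective, (S₁ hN).θ_one,
    fun _ z hq => (S₁ hN).θ_mul_of_mem (mem_Qb_iff.mpr hq) z, (S₁ hN).θ_add, fun _ => rfl⟩

/-- (E3) Hermite–Lindemann for `E₁`. [cite: Lindemann1882] -/
theorem hermiteLindemannE_E₁ (hN : nesterenko) : HermiteLindemannE (E₁ hN) :=
  fun hα h0 => (S₁ hN).hermiteLindemann_E hα h0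

/-- (E3) Lindemann–Weierstrass for `E₁`. [cite: Weierstrass1885] -/
theorem lindemannWeierstrassE_E₁ (hN : nesterenko) : LindemannWeierstrassE (E₁ hN) :=
  fun α halg hli => (S₁ hN).lindemannWeierstrass_E α halg hli

/-- (E3) Gelfond–Schneider for `E₁`. [cite: Gelfond1934] -/
theorem gelfondSchneiderE_E₁ (hN : nesterenko) : GelfondSchneiderE (E₁ hN) :=
  fun ha hb hbq hl hl0 => (S₁ hN).gelfondSchneider_E ha hb hbq hl hl0

/-- (E3) Baker for `E₁`. [cite: Baker1966, 68] -/
theorem bakerE_E₁ (hN : nesterenko) : BakerE (E₁ hN) := fun l halg hli => (S₁ hN).baker_E l halg hli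

/-- (E4) `S_{E₁}(1)`. [folklore] -/
theorem schanuelRankE_E₁_one (hN : nesterenko) : SchanuelRankE (E₁ hN) 1 :=
  schanuelRankE_one_of_HL (E₁ hN) (hermiteLindemannE_E₁ hN)

/-- `E₁` has the algebraic-point transcendence package of part 05. [folklore] -/
theorem transcendencePackage_E₁ (hN : nesterenko) : TranscendencePackage (E₁ hN) :=
  ⟨isInvolutiveExp_E₁ hN, agreesOnQbar_E₁ hN, lindemannWeierstrassE_E₁ hN, hermiteLindemannE_E₁ hN,
    gelfondSchneiderE_E₁ hN, bakerE_E₁ hN, schanuelRankE_E₁_one hN⟩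

/-! ## §6 Nesterenko's theorem holds VERBATIM for `E₁` -/

end Model

/-- Nesterenko's corollary phrased for an exponential `E : ℂ → ℂ`: `π, E π, Γ(1/4)` are
algebraically independent over `ℚ` (at `E = exp` this is the tree's `nesterenko`, complexified).
[cite: Nesterenko1996SbMath, Theorem 1 and its corollaries] -/
def NesterenkoE (E : ℂ → ℂ) : Prop :=
  AlgebraicIndependent ℚ ![(Real.pi : ℂ), E Real.pi, (Real.Gamma (1 / 4) : ℂ)]

/-- `NesterenkoE exp` from the tree's (real) `nesterenko`. [cite: Nesterenko1996SbMath, Theorem 1 and its corollaries] -/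
theorem nesterenkoE_exp (hN : nesterenko) : NesterenkoE cexp := by
  have hN' : AlgebraicIndependent ℚ ![Real.pi, Real.exp Real.pi, Real.Gamma (1 / 4)] := hN
  have h := hN'.map' (f := (AlgHom.restrictScalars ℚ Complex.ofRealAm : ℝ →ₐ[ℚ] ℂ))
    Complex.ofReal_injective
  have e : ((AlgHom.restrictScalars ℚ Complex.ofRealAm : ℝ →ₐ[ℚ] ℂ) : ℝ → ℂ) ∘
      ![Real.pi, Real.exp Real.pi, Real.Gamma (1 / 4)] =
      ![(Real.pi : ℂ), cexp Real.pi, (Real.Gamma (1 / 4) : ℂ)] := by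
    funext i; fin_cases i <;> simp [Complex.ofReal_exp]
  rw [e] at h
  exact h

section Verdicts


/-- **Nesterenko holds for `E₁`** (`E₁ π = e^π`). [cite: Nesterenko1996SbMath, Theorem 1 and its corollaries] -/
theorem nesterenkoE_E₁ (hN : nesterenko) : NesterenkoE (E₁ hN) := by
  unfold NesterenkoE
  rw [E₁_pi]
  exact nesterenkoE_exp hN

/-! ## §7 The verdicts: `X(2)` fails at `r = (π, e^π)`, `S(3)` fails at `(iπ, π, e^π)`;
the length-one `π`-cell HOLDS -/

/-- `K₁ = ℚ(π, e^π, 2^i)`, `trdeg ≤ 3`. [folklore] -/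
def K₁ : IntermediateField ℚ ℂ :=
  IntermediateField.adjoin ℚ (Set.range ![(Real.pi : ℂ), cexp Real.pi, w₀])

/-- `trdeg_ℚ K₁ ≤ 3` (three generators). [folklore] -/
theorem trdeg_K₁_le : Algebra.trdeg ℚ K₁ ≤ ((3 : ℕ) : Cardinal) := by
  refine (RootDecomp1BTameFlagCore.trdeg_adjoin_le_cardinalMk _).trans ?_
  refine Cardinal.mk_range_le.trans ?_
  simp

/-- `π ∈ K₁`. [folklore] -/
theorem pi_mem_K₁ : (Real.pi : ℂ) ∈ K₁ := IntermediateField.subset_adjoin ℚ _ ⟨0, rfl⟩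
/-- `e^π ∈ K₁`. [folklore] -/
theorem expPi_mem_K₁ : cexp Real.pi ∈ K₁ := IntermediateField.subset_adjoin ℚ _ ⟨1, rfl⟩
/-- `2^i ∈ K₁`. [folklore] -/
theorem w₀_mem_K₁ : w₀ ∈ K₁ := IntermediateField.subset_adjoin ℚ _ ⟨2, rfl⟩

/-- `π` is algebraic over `K₁`. [folklore] -/
theorem alg₁_pi : IsAlgebraic K₁ (Real.pi : ℂ) := isAlgebraic_of_mem' pi_mem_K₁
/-- `e^π` is algebraic over `K₁`. [folklore] -/
theorem alg₁_expPi : IsAlgebraic K₁ ((Real.exp Real.pi : ℝ) : ℂ) := by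
  rw [Complex.ofReal_exp]; exact isAlgebraic_of_mem' expPi_mem_K₁
/-- `i` is algebraic over `K₁`. [folklore] -/
theorem alg₁_I : IsAlgebraic K₁ I := I_isAlgebraic'.tower_top (L := K₁)
/-- `iπ` is algebraic over `K₁`. [folklore] -/
theorem alg₁_piI : IsAlgebraic K₁ ((Real.pi : ℂ) * I) := alg₁_pi.mul alg₁_I
/-- `ie^π` is algebraic over `K₁`. [folklore] -/
theorem alg₁_expPiI : IsAlgebraic K₁ (((Real.exp Real.pi : ℝ) : ℂ) * I) := alg₁_expPi.mul alg₁_I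
/-- `E₁ π = e^π` is algebraic over `K₁`. [folklore] -/
theorem alg₁_E₁pi (hN : nesterenko) : IsAlgebraic K₁ (E₁ hN (Real.pi : ℂ)) := by
  rw [E₁_pi]; exact isAlgebraic_of_mem' expPi_mem_K₁
/-- `E₁ (iπ) = -1` is algebraic over `K₁`. [folklore] -/
theorem alg₁_E₁piI (hN : nesterenko) : IsAlgebraic K₁ (E₁ hN ((Real.pi : ℂ) * I)) := by
  rw [E₁_pi_mul_I]; exact neg_one_isAlgebraic'.tower_top (L := K₁)
/-- `E₁ (e^π) = 2` is algebraic over `K₁`. [folklore] -/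
theorem alg₁_E₁expPi (hN : nesterenko) : IsAlgebraic K₁ (E₁ hN ((Real.exp Real.pi : ℝ) : ℂ)) := by
  rw [E₁_expPi]; exact two_isAlgebraic'.tower_top (L := K₁)
/-- `E₁ (ie^π) = 2^i` is algebraic over `K₁`. [folklore] -/
theorem alg₁_E₁expPiI (hN : nesterenko) : IsAlgebraic K₁ (E₁ hN (((Real.exp Real.pi : ℝ) : ℂ) * I)) := by
  rw [E₁_expPi_mul_I]; exact isAlgebraic_of_mem' w₀_mem_K₁

/-- The polar generating set of `r = (π, e^π)` together with its `E₁`-values is algebraic over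
`K₁ = ℚ(π, e^π, 2^i)`. [folklore] -/
theorem polar_algebraic₁ (hN : nesterenko) : ∀ x ∈ Set.range (Fin.append (fun j => (((![Real.pi, Real.exp Real.pi] : Fin 2 → ℝ) j : ℝ) : ℂ)) (fun j => (((![Real.pi, Real.exp Real.pi] : Fin 2 → ℝ) j : ℝ) : ℂ) * Complex.I)) ∪ Set.range (E₁ hN ∘ Fin.append (fun j => (((![Real.pi, Real.exp Real.pi] : Fin 2 → ℝ) j : ℝ) : ℂ)) (fun j => (((![Real.pi, Real.exp Real.pi] : Fin 2 → ℝ) j : ℝ) : ℂ) * Complex.I)), IsAlgebraic K₁ x := by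
  rintro x (⟨i, rfl⟩ | ⟨i, rfl⟩)
  · refine Fin.addCases (fun j => ?_) (fun j => ?_) i
    · rw [Fin.append_left]
      fin_cases j
      · simpa using alg₁_pi
      · simpa using alg₁_expPi
    · rw [Fin.append_right]
      fin_cases j
      · simpa using alg₁_piI
      · simpa using alg₁_expPiI
  · refine Fin.addCases (fun j => ?_) (fun j => ?_) i
    · simp only [Function.comp_apply]
      rw [Fin.append_left]
      fin_cases j
      · simpa using alg₁_E₁pi hN
      · simpa using alg₁_E₁expPi hN
    · simp only [Function.comp_apply]
      rw [Fin.append_right]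
      fin_cases j
      · simpa using alg₁_E₁piI hN
      · simpa using alg₁_E₁expPiI hN

/-- **X(2) FAILS for `E₁`** at the `ℚ`-free real pair `r = (π, e^π)`:
`trdeg ℚ(π, e^π, iπ, ie^π, E₁ π, E₁ e^π, E₁(iπ), E₁(ie^π)) = trdeg ℚ(π, e^π, iπ, ie^π, e^π, 2, -1, 2^i) ≤ 3 < 4`.
[folklore] -/
theorem not_kleinPolarE_E₁ (hN : nesterenko) : ¬ KleinPolarE (E₁ hN) := by
  intro h
  have h1 := (h 2 ![Real.pi, Real.exp Real.pi] (linearIndependent_pi_expPi hN)).trans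
    ((RootDecomp1EAnchor.trdeg_adjoin_le_of_isAlgebraic (polar_algebraic₁ hN)).trans trdeg_K₁_le)
  have h2 : (2 + 2 : ℕ) ≤ 3 := by exact_mod_cast h1
  omega

/-- `K₂ = ℚ(π, e^π)`, `trdeg ≤ 2`. [folklore] -/
def K₂ : IntermediateField ℚ ℂ :=
  IntermediateField.adjoin ℚ (Set.range ![(Real.pi : ℂ), cexp Real.pi])

/-- `trdeg_ℚ K₂ ≤ 2` (two generators). [folklore] -/
theorem trdeg_K₂_le : Algebra.trdeg ℚ K₂ ≤ ((2 : ℕ) : Cardinal) := by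
  refine (RootDecomp1BTameFlagCore.trdeg_adjoin_le_cardinalMk _).trans ?_
  refine Cardinal.mk_range_le.trans ?_
  simp

/-- `π ∈ K₂`. [folklore] -/
theorem pi_mem_K₂ : (Real.pi : ℂ) ∈ K₂ := IntermediateField.subset_adjoin ℚ _ ⟨0, rfl⟩
/-- `e^π ∈ K₂`. [folklore] -/
theorem expPi_mem_K₂ : cexp Real.pi ∈ K₂ := IntermediateField.subset_adjoin ℚ _ ⟨1, rfl⟩

/-- The `ℚ`-free triple `(iπ, π, e^π)`. [cite: Nesterenko1996SbMath, Theorem 1 and its corollaries] -/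
theorem linearIndependent_triple (hN : nesterenko) :
    LinearIndependent ℚ ![(Real.pi : ℂ) * I, (Real.pi : ℂ), ((Real.exp Real.pi : ℝ) : ℂ)] := by
  rw [Fintype.linearIndependent_iff]
  intro g hg
  rw [Fin.sum_univ_three] at hg
  simp only [Matrix.cons_val_zero, Matrix.cons_val_one, Matrix.cons_val] at hg
  rw [Rat.smul_def, Rat.smul_def, Rat.smul_def] at hg
  have hre := congrArg Complex.re hg
  have him := congrArg Complex.im hg
  simp [Real.pi_ne_zero] at hre him
  -- him : g 0 = 0 ; hre : ↑(g 1) * π + ↑(g 2) * rexp π = 0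
  have h12 := LinearIndependent.pair_iff.mp (linearIndependent_pi_expPi hN) (g 1) (g 2)
    (by rw [Rat.smul_def, Rat.smul_def]; exact hre)
  intro i
  fin_cases i
  · exact him
  · exact h12.1
  · exact h12.2

/-- The triple `(iπ, π, e^π)` and its `E₁`-values `(-1, e^π, 2)` are algebraic over `K₂ = ℚ(π, e^π)`.
[folklore] -/
theorem triple_algebraic (hN : nesterenko) : ∀ x ∈ Set.range ![(Real.pi : ℂ) * I, (Real.pi : ℂ), ((Real.exp Real.pi : ℝ) : ℂ)] ∪
    Set.range (E₁ hN ∘ ![(Real.pi : ℂ) * I, (Real.pi : ℂ), ((Real.exp Real.pi : ℝ) : ℂ)]),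
    IsAlgebraic K₂ x := by
  have aI : IsAlgebraic K₂ I := I_isAlgebraic'.tower_top (L := K₂)
  have aπ : IsAlgebraic K₂ (Real.pi : ℂ) := isAlgebraic_of_mem' pi_mem_K₂
  have ae : IsAlgebraic K₂ (cexp Real.pi) := isAlgebraic_of_mem' expPi_mem_K₂
  rintro x (⟨j, rfl⟩ | ⟨j, rfl⟩) <;> fin_cases j
  · simpa using aπ.mul aI
  · simpa using aπ
  · simpa [Complex.ofReal_exp] using ae
  · simpa [E₁_pi_mul_I] using neg_one_isAlgebraic'.tower_top (L := K₂)
  · simpa [E₁_pi] using ae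
  · simpa [E₁_cexpPi] using two_isAlgebraic'.tower_top (L := K₂)

/-- **S_{E₁}(3) FAILS** at the `ℚ`-free, conjugation-stable triple `(iπ, π, e^π)`:
`trdeg ℚ(iπ, π, e^π, -1, e^π, 2) = 2 < 3`. [folklore] -/
theorem not_schanuelRankE_E₁_three (hN : nesterenko) : ¬ SchanuelRankE (E₁ hN) 3 := by
  intro h
  have h1 := (h _ (linearIndependent_triple hN)).trans
    ((RootDecomp1EAnchor.trdeg_adjoin_le_of_isAlgebraic (triple_algebraic hN)).trans trdeg_K₂_le)
  have h2 : (3 : ℕ) ≤ 2 := by exact_mod_cast h1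
  omega

/-- **The summit text FAILS for `E₁`.** [folklore] -/
theorem not_schanuelE_E₁ (hN : nesterenko) : ¬ SchanuelE (E₁ hN) := fun h => not_schanuelRankE_E₁_three hN (h 3)

/-- … whereas the LENGTH-ONE Klein-polar cell at `r = (π)` HOLDS for `E₁`:
`trdeg ℚ(π, iπ, E₁ π, E₁(iπ)) = trdeg ℚ(π, e^π) = 2` (Nesterenko). The failure of `X` for `E₁`
first appears at length two. [cite: Nesterenko1996SbMath, Theorem 1 and its corollaries] -/
theorem kleinPolar_pi_cell_E₁ (hN : nesterenko) : ((1 + 1 : ℕ) : Cardinal) ≤ Algebra.trdeg ℚ ↥(IntermediateField.adjoin ℚ (Set.range (Fin.append (fun j => (((![Real.pi] : Fin 1 → ℝ) j : ℝ) : ℂ)) (fun j => (((![Real.pi] : Fin 1 → ℝ) j : ℝ) : ℂ) * Complex.I)) ∪ Set.range (E₁ hN ∘ Fin.append (fun j => (((![Real.pi] : Fin 1 → ℝ) j : ℝ) : ℂ)) (fun j => (((![Real.pi] : Fin 1 → ℝ) j : ℝ) : ℂ) * Complex.I)))) := by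
  set L := IntermediateField.adjoin ℚ (Set.range (Fin.append (fun j => (((![Real.pi] : Fin 1 → ℝ) j : ℝ) : ℂ)) (fun j => (((![Real.pi] : Fin 1 → ℝ) j : ℝ) : ℂ) * Complex.I)) ∪ Set.range (E₁ hN ∘ Fin.append (fun j => (((![Real.pi] : Fin 1 → ℝ) j : ℝ) : ℂ)) (fun j => (((![Real.pi] : Fin 1 → ℝ) j : ℝ) : ℂ) * Complex.I))) with hL
  have hπ : (Real.pi : ℂ) ∈ L := by
    refine IntermediateField.subset_adjoin ℚ _ (Set.mem_union_left _ ⟨Fin.castAdd 1 0, ?_⟩)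
    rw [Fin.append_left]
    rfl
  have hE : cexp Real.pi ∈ L := by
    refine IntermediateField.subset_adjoin ℚ _ (Set.mem_union_right _ ⟨Fin.castAdd 1 0, ?_⟩)
    rw [Function.comp_apply, Fin.append_left, ← E₁_pi hN]
    rfl
  have hx : AlgebraicIndependent ℚ ![(⟨Real.pi, hπ⟩ : L), ⟨cexp Real.pi, hE⟩] := by
    refine AlgebraicIndependent.of_comp L.val ?_
    convert algebraicIndependent_pi_expPi_complex hN using 1
    funext i; fin_cases i <;> rfl
  have h := hx.cardinalMk_le_trdeg
  rw [Cardinal.mk_fin] at h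
  exact h

end Verdicts

/-! ## §8 The PERIOD PACKAGE and the headline `_false_without_` statements -/

/-- TRUE KERNEL: `ker E = 2πiℤ`, the kernel of `exp`. [folklore] -/
def TrueKernel (E : ℂ → ℂ) : Prop := ∀ z : ℂ, E z = 1 ↔ ∃ n : ℤ, z = n * (2 * Real.pi * I)

/-- AGREEMENT WITH `exp` ON THE PERIOD PLANE `ℚ̄ ⊕ ℚ̄·π` (`⊇ ℚ̄ ⊕ ℚ̄·2πi`). [folklore] -/
def AgreesOnPeriodPlane (E : ℂ → ℂ) : Prop :=
  ∀ p q : ℂ, IsAlgebraic ℚ p → IsAlgebraic ℚ q → E (p + q * Real.pi) = cexp (p + q * Real.pi)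

/-- **The period package** (the name is ours): the algebraic-point transcendence package (E1)–(E4)
of part 05, PLUS (P1) the true kernel `2πiℤ`, (P2) agreement with `exp` on `ℚ̄ ⊕ ℚ̄π`, (P3)
Nesterenko's theorem verbatim for `E`. [cite: Nesterenko1996SbMath, Theorem 1 and its corollaries] -/
def PeriodPackage (E : ℂ → ℂ) : Prop :=
  TranscendencePackage E ∧ TrueKernel E ∧ AgreesOnPeriodPlane E ∧ NesterenkoE E

/-- `exp` has the period package. [cite: Nesterenko1996SbMath, Theorem 1 and its corollaries] -/
theorem periodPackage_exp (hN : nesterenko) : PeriodPackage cexp :=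
  ⟨transcendencePackage_exp, fun _ => Complex.exp_eq_one_iff, fun _ _ _ _ => rfl, nesterenkoE_exp hN⟩

/-- The period-true sheared exponential `E₁` has the period package. [folklore] -/
theorem periodPackage_E₁ (hN : nesterenko) : PeriodPackage (E₁ hN) :=
  ⟨transcendencePackage_E₁ hN, E₁_eq_one_iff hN, fun _ _ hp hq => E₁_add_mul_pi hN hp hq,
    nesterenkoE_E₁ hN⟩

/-- … and is nevertheless discontinuous and differs from `exp` (at `e^π`). [folklore] -/
theorem periodPackage_E₁_not_exp (hN : nesterenko) :
    PeriodPackage (E₁ hN) ∧ ¬ Continuous (E₁ hN) ∧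
      E₁ hN ((Real.exp Real.pi : ℝ) : ℂ) ≠ cexp ((Real.exp Real.pi : ℝ) : ℂ) :=
  ⟨periodPackage_E₁ hN, not_continuous_E₁ hN, E₁_expPi_ne_exp hN⟩

/-- **`KleinPolarSchanuel` is FALSE WITHOUT a channel beyond the period package**: granted
Nesterenko's theorem, not every exponential with (E1)–(E4), true kernel `2πiℤ`, `E = exp` on
`ℚ̄ ⊕ ℚ̄π` and Nesterenko verbatim satisfies Klein-polar Schanuel — `E₁` violates it at length `2`
(`r = (π, e^π)`). [folklore] -/
theorem kleinPolarSchanuel_false_without_channel_beyond_periods (hN : nesterenko) :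
    ¬ ∀ E : ℂ → ℂ, PeriodPackage E → KleinPolarE E :=
  fun h => not_kleinPolarE_E₁ hN (h _ (periodPackage_E₁ hN))

/-- **`SchanuelRank 3` is FALSE WITHOUT a channel beyond the period package** (at the `ℚ`-free,
`conj`-stable triple `(iπ, π, e^π)`). [cite: Roy2001, §1] -/
theorem schanuelRank_three_false_without_channel_beyond_periods (hN : nesterenko) :
    ¬ ∀ E : ℂ → ℂ, PeriodPackage E → SchanuelRankE E 3 :=
  fun h => not_schanuelRankE_E₁_three hN (h _ (periodPackage_E₁ hN))

/-- **The summit text is FALSE WITHOUT a channel beyond the period package.**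
[cite: Waldschmidt2000, §1.4] -/
theorem schanuel_false_without_channel_beyond_periods (hN : nesterenko) :
    ¬ ∀ E : ℂ → ℂ, PeriodPackage E → SchanuelE E :=
  fun h => not_schanuelE_E₁ hN (h _ (periodPackage_E₁ hN))

/-- **PERIOD-KERNEL FLOOR** (existence form, granted Nesterenko): an exponential `E` on `ℂ` with
the algebraic-point transcendence package, the TRUE kernel `2πiℤ`, `E = exp` on `ℚ̄ ⊕ ℚ̄π`,
Nesterenko's theorem verbatim and the length-one Klein-polar cell at `π`, which is discontinuous and
for which Klein-polar Schanuel (length `2`), `SchanuelRank 3` and `Schanuel` FAIL. [folklore] -/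
theorem periodKernelFloor (hN : nesterenko) :
    ∃ E : ℂ → ℂ, PeriodPackage E ∧ ¬ Continuous E ∧
      ((1 + 1 : ℕ) : Cardinal) ≤ Algebra.trdeg ℚ ↥(IntermediateField.adjoin ℚ (Set.range (Fin.append (fun j => (((![Real.pi] : Fin 1 → ℝ) j : ℝ) : ℂ)) (fun j => (((![Real.pi] : Fin 1 → ℝ) j : ℝ) : ℂ) * Complex.I)) ∪ Set.range (E ∘ Fin.append (fun j => (((![Real.pi] : Fin 1 → ℝ) j : ℝ) : ℂ)) (fun j => (((![Real.pi] : Fin 1 → ℝ) j : ℝ) : ℂ) * Complex.I)))) ∧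
      ¬ KleinPolarE E ∧ ¬ SchanuelRankE E 3 ∧ ¬ SchanuelE E :=
  ⟨E₁ hN, periodPackage_E₁ hN, not_continuous_E₁ hN, kleinPolar_pi_cell_E₁ hN, not_kleinPolarE_E₁ hN,
    not_schanuelRankE_E₁_three hN, not_schanuelE_E₁ hN⟩

/-- DICTIONARY: the genuine exponential has the period package, and its instances of the three
failing statements ARE the crux `KleinPolarSchanuel` (stmt-Schanuel-24622), the tree's
`SchanuelRank 3` and the summit `Schanuel` (`Iff.rfl`) — so none of them follows from the period
package. [cite: Waldschmidt2000, §1.4] -/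
theorem periodPackage_exp_dictionary (hN : nesterenko) :
    PeriodPackage cexp ∧
      (KleinPolarE cexp ↔ Summit.Schanuel.Schanuel.Theses.RootDecomp1B.KleinPolarSchanuel) ∧
      (SchanuelRankE cexp 3 ↔ SchanuelRank 3) ∧ (SchanuelE cexp ↔ Schanuel) :=
  ⟨periodPackage_exp hN, kleinPolarE_exp_iff, schanuelRankE_exp_iff 3, schanuelE_exp_iff⟩

end Summit.Schanuel.Schanuel.Theorems.RootDecomp1BPeriodKernelFloor

end
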